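import Literature.NumberTheory.Sieve.IwaniecAlmostPrimesLinearModel
import Literature.NumberTheory.Sieve.IwaniecAlmostPrimesDispersion
import HarnessLib

/-!
# Iwaniec (1978), §4: the `W`-counts in Lemma-4 form (the conditions (19)–(20), p. 183) — PROVED

H. Iwaniec, *Almost-primes represented by quadratic polynomials*, Invent. Math. **47** (1978)
171–188, §4, p. 183: in `W(x; M, N) = ∑ b_{n₁} b_{n₂} T(n₁, n₂; x, M)` the pairs `(l₁, l₂)` are
fixed and the count over `(m, v)` of `v² + 1 ≡ 0 (m)`, `(v + ml₁)² + 1 ≡ 0 (n₁)`,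
`(v + ml₂)² + 1 ≡ 0 (n₂)` (19) is rewritten, with `c` the solution of
`c ≡ l₁ (mod n₁/(n₁,n₂))`, `c ≡ l₂ (mod n₂/(n₁,n₂))`, `c ≡ l₁ (mod (n₁,n₂))`, `Ω = cm + v`, as
`Ω² + 1 ≡ 0 (mod m[n₁,n₂])`, `cm ≤ Ω < (c+1)m` (20) together with a condition modulo a divisor of
`d = (n₁, n₂)` — "the innermost sum is `P(M₁, M; q, d, μ, ω, α, β)`" with `q = [n₁,n₂]`.
Sixth file of the inline proof of Proposition 1
(`Literature.NumberTheory.Sieve.Iwaniec1978.proposition1`); pure arithmetic, everything PROVED,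
no named facts.  The analysis of the condition modulo `d` is done WITHOUT the paper's case
distinction on the roots `±i` modulo the primes of `d`: with `u = v + ml₁` (a root mod `d`) and
`H = l₂ − l₁`, `(u + mH)² + 1 − (u² + 1) = mH(2u + mH)`, so for squarefree `d` prime to `m`,
`d ∣ (u + mH)² + 1 ⇔ d₂ ∣ 2u + mH = 2v + m(l₁ + l₂)` where `d₂ = d/(d, H)` (`(d₂, H) = 1`);
in particular the count vanishes when `2 ∣ d₂`.

* `dtwo d l₁ l₂ = d/(d, |l₁ − l₂|)` (`∣ d`, prime to `(d, |l₁−l₂|)` and to `l₁ − l₂` for `d`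
  squarefree), `crtc n₁ n₂ l₁ l₂` (the window index `c < [n₁,n₂]`), `omegaOf d₂ c l₁ l₂ μ`
  (`= μ(2c − l₁ − l₂)/2 mod d₂`, the class of `Θ` for `m ≡ μ`), `modEq_omegaOf_iff`;
* `dvd_sq_add_one_iff_dtwo_dvd` (the key step above), `not_dvd_of_two_dvd_dtwo`;
* `wpair_eq` — **(19) ⇔ (20) for one `m`**: `wpair m n₁ n₂ l₁ l₂ = 0` if `2 ∣ d₂`, and otherwise
  `= #{Θ root mod m[n₁,n₂] : ⌊Θ/m⌋ = c, Θ ≡ ω(m mod d₂) (mod d₂)}` (`(m, n₁n₂) = 1`, `m ≥ 1`);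
* `sum_wpair_eq_sum_windowCount` — **summed over `A < m ≤ t`, `(m, n₁n₂) = 1`**:
  `= [2 ∤ d₂] ∑_{μ mod d₂} P_c(A, t; q, q, d₂, μ, ω(μ))` (`windowCount`, `q = [n₁, n₂]`);
* `card_admissible_eq` — the classes `μ` prime to `d₂` with `ω(μ)` a root mod `d₂` are `ρ(d₂)` in
  number (`μ ↦ μw` is a bijection of units, `w = (2c−l₁−l₂)/2 ≡ (l₁−l₂)/2`); `rho_div_mul_rho`,
  `rho_mul_rho_eq` (`ρ(q/d₂)ρ(d₂) = ρ(q)`, `ρ(n₁)ρ(n₂) = ρ([n₁,n₂])ρ((n₁,n₂))`), `coprime_lcm_iff`.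

## References

* H. Iwaniec, Invent. Math. 47 (1978) 171–188, §4 p. 183, (19)–(20) (`IwaniecInventiones1978`).
-/

noncomputable section

open Finset Real

namespace Literature.NumberTheory.Sieve.Iwaniec1978

/-! ### Arithmetic of the pair `(n₁, n₂)`: `d = (n₁, n₂)`, `q = [n₁, n₂]`, `d₂ = d/(d, l₁ − l₂)` -/

/-- `d₂(l₁, l₂) = d / (d, |l₁ − l₂|)`, the part of `d = (n₁, n₂)` prime to `l₁ − l₂`
(p. 183: the modulus of the extra congruence on `Θ`). [cite: IwaniecInventiones1978, §4 p. 183] -/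
def dtwo (d l₁ l₂ : ℕ) : ℕ := d / Nat.gcd d (Int.natAbs ((l₁ : ℤ) - l₂))

/-- `d₂ ∣ d`. [folklore] -/
theorem dtwo_dvd (d l₁ l₂ : ℕ) : dtwo d l₁ l₂ ∣ d :=
  Nat.div_dvd_of_dvd (Nat.gcd_dvd_left _ _)

/-- `d = (d, |l₁ − l₂|) · d₂`. [folklore] -/
theorem gcd_mul_dtwo (d l₁ l₂ : ℕ) : Nat.gcd d (Int.natAbs ((l₁ : ℤ) - l₂)) * dtwo d l₁ l₂ = d := by
  unfold dtwo
  rw [mul_comm, Nat.div_mul_cancel (Nat.gcd_dvd_left _ _)]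

/-- For squarefree `d`: `d₂` is prime to `(d, |l₁ − l₂|)` and to `l₁ − l₂`. [folklore] -/
theorem coprime_dtwo {d : ℕ} (hd : Squarefree d) (l₁ l₂ : ℕ) :
    (dtwo d l₁ l₂).Coprime (Nat.gcd d (Int.natAbs ((l₁ : ℤ) - l₂))) ∧
      (dtwo d l₁ l₂).Coprime (Int.natAbs ((l₁ : ℤ) - l₂)) := by
  set d₁ := Nat.gcd d (Int.natAbs ((l₁ : ℤ) - l₂)) with hd₁
  set d₂ := dtwo d l₁ l₂ with hd₂
  have hprod : d₁ * d₂ = d := gcd_mul_dtwo d l₁ l₂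
  have h1 : d₂.Coprime d₁ := by
    have := hd; rw [← hprod, Nat.squarefree_mul_iff] at this; exact this.1.symm
  refine ⟨h1, ?_⟩
  -- a common divisor of `d₂` and `|l₁ − l₂|` divides `d₁`, hence is `1`
  rw [Nat.Coprime]
  apply Nat.eq_one_of_dvd_one
  rw [← h1]
  refine Nat.dvd_gcd (Nat.gcd_dvd_left _ _) ?_
  rw [hd₁]
  exact Nat.dvd_gcd ((Nat.gcd_dvd_left _ _).trans (hd₂ ▸ dtwo_dvd d l₁ l₂)) (Nat.gcd_dvd_right _ _)

/-- `d₂ = 1` iff … not needed; `0 < d₂` for `0 < d`. [folklore] -/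
theorem dtwo_pos {d : ℕ} (hd : 0 < d) (l₁ l₂ : ℕ) : 0 < dtwo d l₁ l₂ := by
  have h := gcd_mul_dtwo d l₁ l₂
  rcases Nat.eq_zero_or_pos (dtwo d l₁ l₂) with h0 | h0
  · rw [h0, mul_zero] at h; omega
  · exact h0

section Pair

variable {n₁ n₂ : ℕ}

/-- For squarefree `n₁, n₂`: `n₁` is prime to `n₂/(n₁,n₂)`, and `[n₁, n₂] = n₁ · (n₂/(n₁,n₂))`.
[folklore] -/
theorem coprime_div_gcd_of_squarefree (hn₂ : Squarefree n₂) (hn₁ : n₁ ≠ 0) :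
    n₁.Coprime (n₂ / Nat.gcd n₁ n₂) ∧ Nat.lcm n₁ n₂ = n₁ * (n₂ / Nat.gcd n₁ n₂) := by
  have hg0 : 0 < Nat.gcd n₁ n₂ := Nat.gcd_pos_of_pos_left _ (Nat.pos_of_ne_zero hn₁)
  set g := Nat.gcd n₁ n₂ with hg
  set b := n₂ / g with hb
  have hgb : b * g = n₂ := Nat.div_mul_cancel (Nat.gcd_dvd_right n₁ n₂)
  have hbg : b.Coprime g := by
    have := hn₂; rw [← hgb, Nat.squarefree_mul_iff] at this; exact this.1
  constructor
  · -- a common prime of `n₁` and `b` divides `g`, contradicting `(b, g) = 1`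
    rw [Nat.Coprime]
    apply Nat.eq_one_of_dvd_one
    have h1 : Nat.gcd n₁ b ∣ g := by
      rw [hg]
      exact Nat.dvd_gcd (Nat.gcd_dvd_left _ _) ((Nat.gcd_dvd_right _ _).trans (Dvd.intro g hgb))
    have h2 : Nat.gcd n₁ b ∣ b := Nat.gcd_dvd_right _ _
    have := Nat.dvd_gcd h2 h1
    rwa [hbg] at this
  · rw [Nat.lcm, ← hg]
    rw [show n₁ * n₂ / g = n₁ * (n₂ / g) from Nat.mul_div_assoc n₁ (Nat.gcd_dvd_right n₁ n₂)]

end Pair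

/-! ### The window index `c` and the residue `ω(μ)` -/

/-- The window index of the pair `(l₁, l₂)`: `c ≡ l₁ (mod n₁)`, `c ≡ l₂ (mod n₂/(n₁,n₂))`,
`0 ≤ c < [n₁, n₂]` (p. 183: "let `c` be the solution of the system of congruences …").
[cite: IwaniecInventiones1978, §4 p. 183] -/
def crtc (n₁ n₂ l₁ l₂ : ℕ) : ℕ :=
  if h : n₁.Coprime (n₂ / Nat.gcd n₁ n₂) then (Nat.chineseRemainder h l₁ l₂ : ℕ) else 0

/-- The defining congruences and the bound of `c`. [folklore] -/
theorem crtc_spec {n₁ n₂ : ℕ} (hn₂ : Squarefree n₂) (hn₁ : n₁ ≠ 0) (l₁ l₂ : ℕ) :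
    crtc n₁ n₂ l₁ l₂ ≡ l₁ [MOD n₁] ∧ crtc n₁ n₂ l₁ l₂ ≡ l₂ [MOD n₂ / Nat.gcd n₁ n₂] ∧
      crtc n₁ n₂ l₁ l₂ < Nat.lcm n₁ n₂ := by
  obtain ⟨hcop, hlcm⟩ := coprime_div_gcd_of_squarefree hn₂ hn₁
  have hb0 : n₂ / Nat.gcd n₁ n₂ ≠ 0 := by
    intro h
    have := Nat.div_mul_cancel (Nat.gcd_dvd_right n₁ n₂)
    rw [h, zero_mul] at this
    exact hn₂.ne_zero this.symm
  unfold crtc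
  rw [dif_pos hcop]
  set x := Nat.chineseRemainder hcop l₁ l₂
  refine ⟨x.2.1, x.2.2, ?_⟩
  rw [hlcm]
  exact Nat.chineseRemainder_lt_mul hcop l₁ l₂ hn₁ hb0

/-- The residue class of `Θ` modulo `d₂` prescribed by (20), p. 183, for `m ≡ μ (mod d₂)`:
`ω(μ) = μ (2c − l₁ − l₂)/2 (mod d₂)` (`d₂` odd). [cite: IwaniecInventiones1978, §4 p. 183] -/
def omegaOf (d₂ c l₁ l₂ μ : ℕ) : ℕ :=
  ((μ : ZMod d₂) * (2 * (c : ZMod d₂) - l₁ - l₂) * (2 : ZMod d₂)⁻¹).val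

/-- For odd `d₂` and `Θ = v + cm`: `Θ ≡ ω(m mod d₂) (mod d₂) ⇔ d₂ ∣ 2v + m(l₁ + l₂)`. [folklore] -/
theorem modEq_omegaOf_iff {d₂ c l₁ l₂ m v : ℕ} (hd₂ : d₂ % 2 = 1) :
    v + c * m ≡ omegaOf d₂ c l₁ l₂ (m % d₂) [MOD d₂] ↔ d₂ ∣ 2 * v + m * (l₁ + l₂) := by
  have hd0 : 0 < d₂ := by omega
  haveI : NeZero d₂ := ⟨hd0.ne'⟩
  have h2 : IsUnit (2 : ZMod d₂) := by
    refine IsUnit.of_mul_eq_one (((d₂ + 1) / 2 : ℕ) : ZMod d₂) ?_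
    have e : 2 * ((d₂ + 1) / 2) = d₂ + 1 := by omega
    have : ((2 * ((d₂ + 1) / 2) : ℕ) : ZMod d₂) = ((d₂ + 1 : ℕ) : ZMod d₂) := by rw [e]
    push_cast at this
    rw [this, ZMod.natCast_self, zero_add]
  rw [← ZMod.natCast_eq_natCast_iff, omegaOf, ZMod.natCast_zmod_val, ZMod.natCast_mod,
    ← ZMod.natCast_eq_zero_iff]
  push_cast
  constructor
  · intro h
    have h' := congrArg (· * (2 : ZMod d₂)) h
    simp only [mul_assoc, ZMod.inv_mul_of_unit _ h2, mul_one] at h'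
    linear_combination h'
  · intro h
    have h' : ((v : ZMod d₂) + c * m) * 2 = (m : ZMod d₂) * (2 * c - l₁ - l₂) := by
      linear_combination h
    calc (v : ZMod d₂) + c * m = ((v : ZMod d₂) + c * m) * 2 * (2 : ZMod d₂)⁻¹ := by
          rw [mul_assoc, ZMod.mul_inv_of_unit _ h2, mul_one]
      _ = (m : ZMod d₂) * (2 * c - l₁ - l₂) * (2 : ZMod d₂)⁻¹ := by rw [h']

/-! ### The congruence modulo `d`: `d ∣ (u + mH)² + 1 ⇔ d₂ ∣ 2u + mH` -/

/-- **The key step of (19) ⇒ (20)**: if `d` is squarefree, `(m, d) = 1` and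
`d ∣ (v + m l₁)² + 1`, then `d ∣ (v + m l₂)² + 1 ⇔ d₂ ∣ 2v + m(l₁ + l₂)`, `d₂ = d/(d, l₁ − l₂)`:
indeed `(v + ml₂)² − (v + ml₁)² = m (l₂ − l₁)(2v + m(l₁ + l₂))` and `(d₂, l₂ − l₁) = 1`.
[cite: IwaniecInventiones1978, §4 p. 183] -/
theorem dvd_sq_add_one_iff_dtwo_dvd {d m v l₁ l₂ : ℕ} (hd : Squarefree d) (hmd : m.Coprime d)
    (h₁ : d ∣ (v + m * l₁) ^ 2 + 1) :
    d ∣ (v + m * l₂) ^ 2 + 1 ↔ dtwo d l₁ l₂ ∣ 2 * v + m * (l₁ + l₂) := by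
  set d₁ := Nat.gcd d (Int.natAbs ((l₁ : ℤ) - l₂)) with hd₁
  set d₂ := dtwo d l₁ l₂ with hd₂
  set H : ℤ := (l₂ : ℤ) - l₁ with hH
  set S : ℕ := 2 * v + m * (l₁ + l₂) with hS
  have hprod : d₁ * d₂ = d := gcd_mul_dtwo d l₁ l₂
  obtain ⟨-, hcopH⟩ := coprime_dtwo hd l₁ l₂
  have hident : (((v + m * l₂) ^ 2 + 1 : ℕ) : ℤ) - (((v + m * l₁) ^ 2 + 1 : ℕ) : ℤ) =
      (m : ℤ) * H * (S : ℤ) := by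
    rw [hS, hH]; push_cast; ring
  have hd₁H : (d₁ : ℤ) ∣ H := by
    have : d₁ ∣ Int.natAbs ((l₁ : ℤ) - l₂) := Nat.gcd_dvd_right _ _
    have h' : (d₁ : ℤ) ∣ (l₁ : ℤ) - l₂ := Int.natCast_dvd.mpr this
    have : H = -((l₁ : ℤ) - l₂) := by rw [hH]; ring
    rw [this]; exact h'.neg_right
  have hcop2 : IsCoprime (d₂ : ℤ) H := by
    rw [Int.isCoprime_iff_gcd_eq_one, Int.gcd_eq_natAbs, Int.natAbs_natCast]
    have e : H.natAbs = Int.natAbs ((l₁ : ℤ) - l₂) := by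
      rw [hH, ← Int.natAbs_neg]; congr 1; ring
    rw [e]; exact hcopH
  have hcopm : IsCoprime (d : ℤ) (m : ℤ) := Nat.isCoprime_iff_coprime.mpr hmd.symm
  have h₁Z : (d : ℤ) ∣ (((v + m * l₁) ^ 2 + 1 : ℕ) : ℤ) := Int.natCast_dvd_natCast.mpr h₁
  constructor
  · intro h₂
    have h₂Z : (d : ℤ) ∣ (((v + m * l₂) ^ 2 + 1 : ℕ) : ℤ) := Int.natCast_dvd_natCast.mpr h₂
    have hdiff : (d : ℤ) ∣ (m : ℤ) * H * (S : ℤ) := by rw [← hident]; exact dvd_sub h₂Z h₁Z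
    have h3 : (d : ℤ) ∣ H * (S : ℤ) := by
      rw [mul_assoc] at hdiff
      exact hcopm.dvd_of_dvd_mul_left hdiff
    have h4 : (d₂ : ℤ) ∣ H * (S : ℤ) := (Int.natCast_dvd_natCast.mpr (hd₂ ▸ dtwo_dvd d l₁ l₂)).trans h3
    have h5 : (d₂ : ℤ) ∣ (S : ℤ) := hcop2.dvd_of_dvd_mul_left h4
    exact Int.natCast_dvd_natCast.mp h5
  · intro h₂
    have h3 : (d : ℤ) ∣ H * (S : ℤ) := by
      rw [← hprod]; push_cast
      exact mul_dvd_mul hd₁H (Int.natCast_dvd_natCast.mpr h₂)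
    have h4 : (d : ℤ) ∣ (m : ℤ) * H * (S : ℤ) := by rw [mul_assoc]; exact h3.mul_left _
    rw [← hident] at h4
    have h5 := dvd_add h4 h₁Z
    rw [sub_add_cancel] at h5
    exact Int.natCast_dvd_natCast.mp h5

/-- If `2 ∣ d₂` (i.e. `2 ∣ d` and `l₁ ≢ l₂ (mod 2)`), no `v` satisfies (19): the `W`-count is `0`.
[cite: IwaniecInventiones1978, §4 p. 183] -/
theorem not_dvd_of_two_dvd_dtwo {d m v l₁ l₂ : ℕ} (hd : Squarefree d) (hmd : m.Coprime d)
    (h2 : 2 ∣ dtwo d l₁ l₂) (h₁ : d ∣ (v + m * l₁) ^ 2 + 1) : ¬ d ∣ (v + m * l₂) ^ 2 + 1 := by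
  intro h₂
  have hS := (dvd_sq_add_one_iff_dtwo_dvd hd hmd h₁).mp h₂
  have h2S : 2 ∣ 2 * v + m * (l₁ + l₂) := h2.trans hS
  have h2d : 2 ∣ d := h2.trans (dtwo_dvd d l₁ l₂)
  -- `m` is odd
  have hm2 : ¬ 2 ∣ m := by
    intro hm
    have : 2 ∣ Nat.gcd m d := Nat.dvd_gcd hm h2d
    rw [hmd] at this
    omega
  have hsum : 2 ∣ l₁ + l₂ := by
    have : 2 ∣ m * (l₁ + l₂) := by omega
    exact Nat.Coprime.dvd_of_dvd_mul_left ((Nat.Prime.coprime_iff_not_dvd Nat.prime_two).mpr hm2) this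
  -- hence `2 ∣ l₁ − l₂`, so `2 ∣ (d, |l₁ − l₂|)`, contradicting `(d₂, (d, |l₁−l₂|)) = 1`
  have hdiff : 2 ∣ Int.natAbs ((l₁ : ℤ) - l₂) := by
    have : (2 : ℤ) ∣ (l₁ : ℤ) - l₂ := by
      have e : (l₁ : ℤ) - l₂ = ((l₁ + l₂ : ℕ) : ℤ) - 2 * l₂ := by push_cast; ring
      rw [e]
      exact dvd_sub (Int.natCast_dvd_natCast.mpr hsum) (dvd_mul_right 2 _)
    exact Int.natCast_dvd.mp this
  have hd₁ : 2 ∣ Nat.gcd d (Int.natAbs ((l₁ : ℤ) - l₂)) := Nat.dvd_gcd h2d hdiff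
  obtain ⟨hcop, -⟩ := coprime_dtwo hd l₁ l₂
  have : 2 ∣ Nat.gcd (dtwo d l₁ l₂) (Nat.gcd d (Int.natAbs ((l₁ : ℤ) - l₂))) := Nat.dvd_gcd h2 hd₁
  rw [hcop] at this
  omega

/-! ### The `W`-count for one modulus in Lemma-4 form -/

section PerModulus

variable {n₁ n₂ : ℕ}

/-- **The conditions (19) ⇔ (20)** for one `m` (p. 183): for `n₁, n₂` squarefree,
`(m, n₁) = (m, n₂) = 1`, `m ≥ 1`, with `d = (n₁,n₂)`, `q = [n₁,n₂]`, `c = crtc`, `d₂ = dtwo d l₁ l₂`: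
if `2 ∣ d₂` the count `wpair m n₁ n₂ l₁ l₂` vanishes, and otherwise it equals
`#{Θ root mod mq, 0 ≤ Θ < mq : ⌊Θ/m⌋ = c, Θ ≡ ω(m mod d₂) (mod d₂)}`
(`v ↦ Θ = v + cm`). [cite: IwaniecInventiones1978, §4 p. 183] -/
theorem wpair_eq (hn₁ : Squarefree n₁) (hn₂ : Squarefree n₂) {m : ℕ} (hm : 0 < m)
    (hm₁ : m.Coprime n₁) (hm₂ : m.Coprime n₂) (l₁ l₂ : ℕ) :
    wpair m n₁ n₂ l₁ l₂ =
      if 2 ∣ dtwo (Nat.gcd n₁ n₂) l₁ l₂ then 0 else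
        ((rootsNat (m * Nat.lcm n₁ n₂)).filter (fun Θ => Θ / m = crtc n₁ n₂ l₁ l₂ ∧
          Θ ≡ omegaOf (dtwo (Nat.gcd n₁ n₂) l₁ l₂) (crtc n₁ n₂ l₁ l₂) l₁ l₂
            (m % dtwo (Nat.gcd n₁ n₂) l₁ l₂) [MOD dtwo (Nat.gcd n₁ n₂) l₁ l₂])).card := by
  classical
  have hn₁0 : n₁ ≠ 0 := hn₁.ne_zero
  have hn₂0 : n₂ ≠ 0 := hn₂.ne_zero
  set d := Nat.gcd n₁ n₂ with hd
  set b := n₂ / d with hb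
  set q := Nat.lcm n₁ n₂ with hq
  set c := crtc n₁ n₂ l₁ l₂ with hc
  set d₂ := dtwo d l₁ l₂ with hd₂
  have hdpos : 0 < d := Nat.gcd_pos_of_pos_left _ (Nat.pos_of_ne_zero hn₁0)
  have hdsq : Squarefree d := hn₁.squarefree_of_dvd (Nat.gcd_dvd_left _ _)
  have hbd : b * d = n₂ := Nat.div_mul_cancel (Nat.gcd_dvd_right n₁ n₂)
  have hbdc : b.Coprime d := by
    have := hn₂; rw [← hbd, Nat.squarefree_mul_iff] at this; exact this.1
  obtain ⟨hn₁b, hqeq⟩ := coprime_div_gcd_of_squarefree hn₂ hn₁0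
  rw [← hd, ← hb] at hn₁b
  rw [← hq, ← hd, ← hb] at hqeq
  obtain ⟨hc₁, hc₂, hcq⟩ := crtc_spec hn₂ hn₁0 l₁ l₂
  rw [← hc] at hc₁
  rw [← hc, ← hd, ← hb] at hc₂
  rw [← hc, ← hq] at hcq
  have hmd : m.Coprime d := Nat.Coprime.coprime_dvd_right (Nat.gcd_dvd_left _ _) hm₁
  have hmb : m.Coprime b := Nat.Coprime.coprime_dvd_right (Dvd.intro d hbd) hm₂
  have hdn₁ : d ∣ n₁ := Nat.gcd_dvd_left _ _
  have hd₂pos : 0 < d₂ := dtwo_pos hdpos l₁ l₂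
  -- the transport of the conditions
  have hmod₁ : ∀ v : ℕ, (v + c * m) ^ 2 + 1 ≡ (v + m * l₁) ^ 2 + 1 [MOD n₁] := by
    intro v
    have : v + c * m ≡ v + m * l₁ [MOD n₁] := by
      have h := (hc₁.mul_left m)
      rw [show m * c = c * m from mul_comm _ _] at h
      exact h.add_left v
    exact (this.pow 2).add_right 1
  have hmod₂ : ∀ v : ℕ, (v + c * m) ^ 2 + 1 ≡ (v + m * l₂) ^ 2 + 1 [MOD b] := by
    intro v
    have : v + c * m ≡ v + m * l₂ [MOD b] := by
      have h := (hc₂.mul_left m)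
      rw [show m * c = c * m from mul_comm _ _] at h
      exact h.add_left v
    exact (this.pow 2).add_right 1
  have hmodm : ∀ v : ℕ, (v + c * m) ^ 2 + 1 ≡ v ^ 2 + 1 [MOD m] := by
    intro v
    have : v + c * m ≡ v [MOD m] := by
      rw [Nat.ModEq, Nat.add_mul_mod_self_right]
    exact (this.pow 2).add_right 1
  -- `A ⇔ B` for a root `v` mod `m`
  have hkey : ∀ v : ℕ, m ∣ v ^ 2 + 1 →
      ((n₁ ∣ (v + m * l₁) ^ 2 + 1 ∧ n₂ ∣ (v + m * l₂) ^ 2 + 1) ↔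
        (m * q ∣ (v + c * m) ^ 2 + 1 ∧ d₂ ∣ 2 * v + m * (l₁ + l₂))) := by
    intro v hv
    constructor
    · rintro ⟨h₁, h₂⟩
      have hd₁ : d ∣ (v + m * l₁) ^ 2 + 1 := hdn₁.trans h₁
      have hd₂' : d ∣ (v + m * l₂) ^ 2 + 1 := (Dvd.intro_left b hbd).trans h₂
      refine ⟨?_, (dvd_sq_add_one_iff_dtwo_dvd hdsq hmd hd₁).mp hd₂'⟩
      rw [hqeq]
      have hA : m ∣ (v + c * m) ^ 2 + 1 :=
        (Nat.modEq_zero_iff_dvd.mp ((hmodm v).trans (Nat.modEq_zero_iff_dvd.mpr hv)))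
      have hB : n₁ ∣ (v + c * m) ^ 2 + 1 :=
        Nat.modEq_zero_iff_dvd.mp ((hmod₁ v).trans (Nat.modEq_zero_iff_dvd.mpr h₁))
      have hC : b ∣ (v + c * m) ^ 2 + 1 :=
        Nat.modEq_zero_iff_dvd.mp ((hmod₂ v).trans (Nat.modEq_zero_iff_dvd.mpr
          ((Dvd.intro d hbd).trans h₂)))
      rw [← mul_assoc]
      exact (Nat.Coprime.mul_left hmb hn₁b).mul_dvd_of_dvd_of_dvd (hm₁.mul_dvd_of_dvd_of_dvd hA hB) hC
    · rintro ⟨hmq, hS⟩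
      rw [hqeq, ← mul_assoc] at hmq
      have hB : n₁ ∣ (v + c * m) ^ 2 + 1 := (dvd_mul_left n₁ m).trans ((dvd_mul_right _ b).trans hmq)
      have hC : b ∣ (v + c * m) ^ 2 + 1 := (dvd_mul_left b _).trans hmq
      have h₁ : n₁ ∣ (v + m * l₁) ^ 2 + 1 :=
        Nat.modEq_zero_iff_dvd.mp ((hmod₁ v).symm.trans (Nat.modEq_zero_iff_dvd.mpr hB))
      have h₂b : b ∣ (v + m * l₂) ^ 2 + 1 :=
        Nat.modEq_zero_iff_dvd.mp ((hmod₂ v).symm.trans (Nat.modEq_zero_iff_dvd.mpr hC))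
      have hd₁ : d ∣ (v + m * l₁) ^ 2 + 1 := hdn₁.trans h₁
      have h₂d : d ∣ (v + m * l₂) ^ 2 + 1 := (dvd_sq_add_one_iff_dtwo_dvd hdsq hmd hd₁).mpr hS
      refine ⟨h₁, ?_⟩
      rw [← hbd]
      exact hbdc.mul_dvd_of_dvd_of_dvd h₂b h₂d
  -- Case `2 ∣ d₂`: the count vanishes.
  split_ifs with h2
  · unfold wpair
    rw [Finset.card_eq_zero, Finset.filter_eq_empty_iff]
    rintro v - ⟨h₁, h₂⟩
    have hd₁ : d ∣ (v + m * l₁) ^ 2 + 1 := hdn₁.trans h₁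
    exact not_dvd_of_two_dvd_dtwo hdsq hmd h2 hd₁ ((Dvd.intro_left b hbd).trans h₂)
  · -- Case `d₂` odd: the bijection `v ↦ v + c m`
    have hd₂odd : d₂ % 2 = 1 := by omega
    unfold wpair
    refine Finset.card_bij (fun v _ => v + c * m) ?_ ?_ ?_
    · intro v hv
      rw [Finset.mem_filter, mem_rootsNat] at hv
      obtain ⟨⟨hvm, hvroot⟩, hA⟩ := hv
      obtain ⟨hmq, hS⟩ := (hkey v hvroot).mp hA
      rw [Finset.mem_filter, mem_rootsNat]
      refine ⟨⟨?_, hmq⟩, ?_, (modEq_omegaOf_iff hd₂odd).mpr hS⟩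
      · calc v + c * m < m + c * m := Nat.add_lt_add_right hvm _
          _ = (c + 1) * m := by ring
          _ ≤ q * m := Nat.mul_le_mul_right m hcq
          _ = m * q := mul_comm _ _
      · rw [Nat.add_mul_div_right _ _ hm, Nat.div_eq_of_lt hvm, zero_add]
    · intro a _ b _ h
      exact Nat.add_right_cancel h
    · intro Θ hΘ
      rw [Finset.mem_filter, mem_rootsNat] at hΘ
      obtain ⟨⟨hΘlt, hΘroot⟩, hdiv, hω⟩ := hΘ
      have hΘeq : Θ % m + c * m = Θ := by
        have := Nat.mod_add_div Θ m
        rw [hdiv] at this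
        linarith
      refine ⟨Θ % m, ?_, hΘeq⟩
      have hvroot : m ∣ (Θ % m) ^ 2 + 1 := by
        have h1 : m ∣ Θ ^ 2 + 1 := (dvd_mul_right m q).trans hΘroot
        have h2 : (Θ % m) ^ 2 + 1 ≡ Θ ^ 2 + 1 [MOD m] := ((Nat.mod_modEq Θ m).pow 2).add_right 1
        exact Nat.modEq_zero_iff_dvd.mp (h2.trans (Nat.modEq_zero_iff_dvd.mpr h1))
      rw [Finset.mem_filter, mem_rootsNat]
      refine ⟨⟨Nat.mod_lt _ hm, hvroot⟩, ?_⟩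
      refine (hkey (Θ % m) hvroot).mpr ⟨hΘeq.symm ▸ hΘroot, ?_⟩
      rw [← hΘeq] at hω
      exact (modEq_omegaOf_iff hd₂odd).mp hω

end PerModulus

/-! ### Summing over `m`: the classes modulo `d₂` and the Lemma-4 window counts -/

/-- `(m, [n₁, n₂]) = 1 ⇔ (m, n₁) = (m, n₂) = 1`. [folklore] -/
theorem coprime_lcm_iff {m n₁ n₂ : ℕ} :
    m.Coprime (Nat.lcm n₁ n₂) ↔ m.Coprime n₁ ∧ m.Coprime n₂ := by
  constructor
  · intro h
    exact ⟨Nat.Coprime.coprime_dvd_right (Nat.dvd_lcm_left n₁ n₂) h,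
      Nat.Coprime.coprime_dvd_right (Nat.dvd_lcm_right n₁ n₂) h⟩
  · rintro ⟨h1, h2⟩
    have : Nat.lcm n₁ n₂ ∣ n₁ * n₂ := Nat.lcm_dvd_mul n₁ n₂
    exact Nat.Coprime.coprime_dvd_right this (Nat.Coprime.mul_right h1 h2)

section Sum

variable {n₁ n₂ : ℕ}

/-- **The `W`-count for fixed `(l₁, l₂)` as a sum of Lemma-4 window counts over the classes
`μ = m mod d₂`** (p. 183: "The innermost sum is `P(M₁, M; q, d, μ, ω, α, β)`"):
`∑_{A<m≤t, (m,n₁n₂)=1} wpair(m) = [d₂ odd] ∑_{μ mod d₂} P_c(A, t; q, q, d₂, μ, ω(μ))`.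
[cite: IwaniecInventiones1978, §4 p. 183] -/
theorem sum_wpair_eq_sum_windowCount (hn₁ : Squarefree n₁) (hn₂ : Squarefree n₂) (l₁ l₂ A t : ℕ) :
    ∑ m ∈ (Finset.Ioc A t).filter (fun m : ℕ => n₁.Coprime m ∧ n₂.Coprime m),
        (wpair m n₁ n₂ l₁ l₂ : ℝ) =
      if 2 ∣ dtwo (Nat.gcd n₁ n₂) l₁ l₂ then 0 else
        ∑ μ ∈ Finset.range (dtwo (Nat.gcd n₁ n₂) l₁ l₂),
          (windowCount (Nat.lcm n₁ n₂) (Nat.lcm n₁ n₂) (dtwo (Nat.gcd n₁ n₂) l₁ l₂) μ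
            (omegaOf (dtwo (Nat.gcd n₁ n₂) l₁ l₂) (crtc n₁ n₂ l₁ l₂) l₁ l₂ μ) A t
            (crtc n₁ n₂ l₁ l₂) : ℝ) := by
  classical
  have hn₁0 : n₁ ≠ 0 := hn₁.ne_zero
  have hn₂0 : n₂ ≠ 0 := hn₂.ne_zero
  set d₂ := dtwo (Nat.gcd n₁ n₂) l₁ l₂ with hd₂
  set q := Nat.lcm n₁ n₂ with hq
  set c := crtc n₁ n₂ l₁ l₂ with hc
  have hd₂pos : 0 < d₂ :=
    dtwo_pos (Nat.gcd_pos_of_pos_left _ (Nat.pos_of_ne_zero hn₁0)) l₁ l₂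
  -- rewrite each `wpair` by the per-modulus identity
  have hper : ∀ m ∈ (Finset.Ioc A t).filter (fun m : ℕ => n₁.Coprime m ∧ n₂.Coprime m),
      (wpair m n₁ n₂ l₁ l₂ : ℝ) = if 2 ∣ d₂ then 0 else
        (((rootsNat (m * q)).filter (fun Θ => Θ / m = c ∧
          Θ ≡ omegaOf d₂ c l₁ l₂ (m % d₂) [MOD d₂])).card : ℝ) := by
    intro m hm
    rw [Finset.mem_filter, Finset.mem_Ioc] at hm
    rw [wpair_eq hn₁ hn₂ (by omega) hm.2.1.symm hm.2.2.symm l₁ l₂, ← hd₂, ← hq, ← hc]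
    push_cast
    rfl
  rw [Finset.sum_congr rfl hper]
  split_ifs with h2
  · simp
  -- the window counts fibrewise in `m`
  simp_rw [windowCount_eq_sum_windowFibre]
  rw [Finset.sum_comm, Finset.sum_filter]
  refine Finset.sum_congr rfl fun m hm => ?_
  rw [Finset.mem_Ioc] at hm
  have hm0 : 0 < m := by omega
  -- only the class `μ = m mod d₂` contributes
  have hμ : ∀ μ ∈ Finset.range d₂, μ ≠ m % d₂ →
      (windowFibre q q d₂ μ (omegaOf d₂ c l₁ l₂ μ) c m : ℝ) = 0 := by
    intro μ hμr hne
    rw [Finset.mem_range] at hμr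
    unfold windowFibre
    rw [if_neg]
    · simp
    · rintro ⟨-, hmod⟩
      apply hne
      rw [Nat.ModEq, Nat.mod_eq_of_lt hμr] at hmod
      exact hmod.symm
  rw [Finset.sum_eq_single_of_mem (m % d₂) (Finset.mem_range.mpr (Nat.mod_lt _ hd₂pos)) hμ]
  unfold windowFibre
  have hmodself : m ≡ m % d₂ [MOD d₂] := (Nat.mod_modEq m d₂).symm
  by_cases hcop : n₁.Coprime m ∧ n₂.Coprime m
  · have hcq : m.Coprime q := coprime_lcm_iff.mpr ⟨hcop.1.symm, hcop.2.symm⟩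
    rw [if_pos hcop, if_pos ⟨hcq, hmodself⟩]
    congr 2
    exact Finset.filter_congr fun Θ _ => and_comm
  · rw [if_neg hcop, if_neg]
    · simp
    · rintro ⟨hcq, -⟩
      have := coprime_lcm_iff.mp hcq
      exact hcop ⟨this.1.symm, this.2.symm⟩

/-- **The admissible classes**: for `d₂` odd, the classes `μ mod d₂` prime to `d₂` with `ω(μ)`
a root of `Ω² + 1` mod `d₂` are `ρ(d₂)` in number (`μ ↦ ω(μ) = μ w`, `w = (2c − l₁ − l₂)/2`
a unit since `2c − l₁ − l₂ ≡ l₁ − l₂ (mod d₂)` and `(d₂, l₁ − l₂) = 1`).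
[cite: IwaniecInventiones1978, §4 p. 183] -/
theorem card_admissible_eq (hn₁ : Squarefree n₁) (hn₂ : Squarefree n₂) (l₁ l₂ : ℕ)
    (hodd : ¬ 2 ∣ dtwo (Nat.gcd n₁ n₂) l₁ l₂) :
    ((Finset.range (dtwo (Nat.gcd n₁ n₂) l₁ l₂)).filter (fun μ : ℕ =>
        μ.Coprime (dtwo (Nat.gcd n₁ n₂) l₁ l₂) ∧
        dtwo (Nat.gcd n₁ n₂) l₁ l₂ ∣
          omegaOf (dtwo (Nat.gcd n₁ n₂) l₁ l₂) (crtc n₁ n₂ l₁ l₂) l₁ l₂ μ ^ 2 + 1)).card =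
      rho (dtwo (Nat.gcd n₁ n₂) l₁ l₂) := by
  classical
  have hn₁0 : n₁ ≠ 0 := hn₁.ne_zero
  set d := Nat.gcd n₁ n₂ with hd
  set d₂ := dtwo d l₁ l₂ with hd₂
  set c := crtc n₁ n₂ l₁ l₂ with hc
  have hdpos : 0 < d := Nat.gcd_pos_of_pos_left _ (Nat.pos_of_ne_zero hn₁0)
  have hdsq : Squarefree d := hn₁.squarefree_of_dvd (Nat.gcd_dvd_left _ _)
  have hd₂pos : 0 < d₂ := dtwo_pos hdpos l₁ l₂
  have hd₂odd : d₂ % 2 = 1 := by omega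
  haveI : NeZero d₂ := ⟨hd₂pos.ne'⟩
  -- the unit `w`
  have h2 : IsUnit (2 : ZMod d₂) := by
    refine IsUnit.of_mul_eq_one (((d₂ + 1) / 2 : ℕ) : ZMod d₂) ?_
    have e : 2 * ((d₂ + 1) / 2) = d₂ + 1 := by omega
    have : ((2 * ((d₂ + 1) / 2) : ℕ) : ZMod d₂) = ((d₂ + 1 : ℕ) : ZMod d₂) := by rw [e]
    push_cast at this
    rw [this, ZMod.natCast_self, zero_add]
  obtain ⟨hc₁, -, -⟩ := crtc_spec hn₂ hn₁0 l₁ l₂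
  rw [← hc] at hc₁
  have hcd₂ : c ≡ l₁ [MOD d₂] :=
    Nat.ModEq.of_dvd ((hd₂ ▸ dtwo_dvd d l₁ l₂).trans (Nat.gcd_dvd_left n₁ n₂)) hc₁
  have hwunit : IsUnit ((2 * (c : ZMod d₂) - l₁ - l₂) * (2 : ZMod d₂)⁻¹) := by
    refine IsUnit.mul ?_ ?_
    · -- `2c − l₁ − l₂ = l₁ − l₂` in `ZMod d₂`, a unit
      have e : (2 * (c : ZMod d₂) - l₁ - l₂) = (((l₁ : ℤ) - l₂ : ℤ) : ZMod d₂) := by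
        have : (c : ZMod d₂) = (l₁ : ZMod d₂) := (ZMod.natCast_eq_natCast_iff _ _ _).mpr hcd₂
        rw [this]; push_cast; ring
      rw [e, ZMod.coe_int_isUnit_iff_isCoprime, Int.isCoprime_iff_gcd_eq_one,
        Int.gcd_eq_natAbs, Int.natAbs_natCast]
      exact (coprime_dtwo hdsq l₁ l₂).2
    · exact IsUnit.of_mul_eq_one (2 : ZMod d₂) (ZMod.inv_mul_of_unit _ h2)
  set w : ZMod d₂ := (2 * (c : ZMod d₂) - l₁ - l₂) * (2 : ZMod d₂)⁻¹ with hw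
  have hω : ∀ μ : ℕ, (omegaOf d₂ c l₁ l₂ μ : ZMod d₂) = (μ : ZMod d₂) * w := by
    intro μ
    unfold omegaOf
    rw [ZMod.natCast_zmod_val, hw, mul_assoc]
  rw [rho_eq_card_filter_zmod]
  refine Finset.card_bij (fun μ _ => (omegaOf d₂ c l₁ l₂ μ : ZMod d₂)) ?_ ?_ ?_
  · intro μ hμ
    rw [Finset.mem_filter] at hμ
    rw [Finset.mem_filter]
    refine ⟨Finset.mem_univ _, ?_⟩
    have := (ZMod.natCast_eq_zero_iff _ _).mpr hμ.2.2
    push_cast at this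
    exact this
  · intro a ha b hb hab
    rw [Finset.mem_filter, Finset.mem_range] at ha hb
    rw [hω, hω] at hab
    have hab' : (a : ZMod d₂) = (b : ZMod d₂) := hwunit.mul_left_injective hab
    have := (ZMod.natCast_eq_natCast_iff' a b d₂).mp hab'
    rwa [Nat.mod_eq_of_lt ha.1, Nat.mod_eq_of_lt hb.1] at this
  · intro y hy
    rw [Finset.mem_filter] at hy
    have hyunit : IsUnit y := by
      refine IsUnit.of_mul_eq_one (-y) ?_
      have : y ^ 2 = -1 := eq_neg_of_add_eq_zero_left hy.2
      linear_combination -this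
    set u : ZMod d₂ := y * (hwunit.unit⁻¹ : (ZMod d₂)ˣ) with hu
    have huw : u * w = y := by rw [hu, mul_assoc, IsUnit.val_inv_mul, mul_one]
    have huunit : IsUnit u := hyunit.mul (Units.isUnit _)
    refine ⟨u.val, ?_, ?_⟩
    · rw [Finset.mem_filter, Finset.mem_range]
      refine ⟨ZMod.val_lt u, ?_, ?_⟩
      · have := ZMod.val_coe_unit_coprime huunit.unit
        rw [IsUnit.unit_spec] at this
        exact this
      · rw [← ZMod.natCast_eq_zero_iff]
        push_cast
        rw [hω, ZMod.natCast_zmod_val, huw]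
        exact hy.2
    · rw [hω, ZMod.natCast_zmod_val, huw]

end Sum

/-! ### Multiplicativity of `ρ` on the pair -/

/-- For squarefree `q` and `e ∣ q`: `ρ(q/e) ρ(e) = ρ(q)`. [folklore] -/
theorem rho_div_mul_rho {q e : ℕ} (hq : Squarefree q) (he : e ∣ q) : rho (q / e) * rho e = rho q := by
  have hq0 : q ≠ 0 := hq.ne_zero
  have heq : q / e * e = q := Nat.div_mul_cancel he
  have he0 : e ≠ 0 := by rintro rfl; rw [mul_zero] at heq; exact hq0 heq.symm
  have hqe0 : q / e ≠ 0 := by intro h; rw [h, zero_mul] at heq; exact hq0 heq.symm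
  have hcop : (q / e).Coprime e := by
    have := hq; rw [← heq, Nat.squarefree_mul_iff] at this; exact this.1
  rw [← rho_mul_of_coprime hqe0 he0 hcop, heq]

/-- For squarefree `n₁, n₂`: `ρ(n₁) ρ(n₂) = ρ([n₁,n₂]) ρ((n₁,n₂))`. [folklore] -/
theorem rho_mul_rho_eq {n₁ n₂ : ℕ} (hn₁ : Squarefree n₁) (hn₂ : Squarefree n₂) :
    rho n₁ * rho n₂ = rho (Nat.lcm n₁ n₂) * rho (Nat.gcd n₁ n₂) := by
  have hn₁0 : n₁ ≠ 0 := hn₁.ne_zero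
  obtain ⟨hcop, hlcm⟩ := coprime_div_gcd_of_squarefree hn₂ hn₁0
  set g := Nat.gcd n₁ n₂
  set b := n₂ / g
  have hbg : b * g = n₂ := Nat.div_mul_cancel (Nat.gcd_dvd_right n₁ n₂)
  have hg0 : g ≠ 0 := (Nat.gcd_pos_of_pos_left _ (Nat.pos_of_ne_zero hn₁0)).ne'
  have hb0 : b ≠ 0 := by rintro h; rw [h, zero_mul] at hbg; exact hn₂.ne_zero hbg.symm
  have hbgc : b.Coprime g := by
    have := hn₂; rw [← hbg, Nat.squarefree_mul_iff] at this; exact this.1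
  rw [hlcm, rho_mul_of_coprime hn₁0 hb0 hcop, ← hbg, rho_mul_of_coprime hb0 hg0 hbgc]
  ring

end Literature.NumberTheory.Sieve.Iwaniec1978

end
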